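import Literature.Topology.FourManifolds.LatticeFormsIndefiniteOdd
import Literature.Topology.FourManifolds.LatticeFormsDefinite
import Literature.Topology.FourManifolds.LatticeFormsProofs
import Literature.NumberTheory.QuadraticForms.HermiteBound
import HarnessLib

/-!
# Unimodular lattices of rank `≤ 5`: small vectors, anisotropic ⇒ definite, Serre's Theorem 3

Trunk T-4MAN; companion of `LatticeFormsRepresentsZero.lean` (the named fact
`LinearMap.BilinForm.exists_isotropic_of_isIndefinite`, Serre, *A Course in Arithmetic*, Ch. V
§2.2 Thm 3: an indefinite unimodular lattice represents zero). Everything here is proved.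

From Hermite's inequality `3^{n(n-1)/2} mⁿ ≤ 4^{n(n-1)/2} |det|`
(`Literature.NumberTheory.QuadraticForms.hermite_bound`, Cassels, *Geometry of Numbers* II.3.2
Thm. I) and `|det| = 1`:

* `exists_ne_zero_natAbs_apply_self_le_one`: a symmetric unimodular lattice of rank `1 ≤ n ≤ 5`
  has a vector `u ≠ 0` with `|u.u| ≤ 1` (since `3^{n(n-1)/2} 2ⁿ > 4^{n(n-1)/2}` for `n ≤ 5`;
  this fails from `n = 6` on with Hermite's constant `(4/3)^{(n-1)/2}`, and is false from `n = 8`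
  on: `E₈`).
* `isDefinite_of_forall_apply_self_ne_zero`: a symmetric unimodular **anisotropic** lattice of
  rank `≤ 5` is definite — split off the vector `u` of square `±1` (Serre's Lemma 2,
  `IsometryEquiv.splitUnit`: `E ≅ ⟨±1⟩ ⊕ u^⊥`), apply induction to `u^⊥`, and note that
  `⟨ε⟩ ⊕ F` with `F` definite of the sign opposite to `ε` contains the isotropic vector `u + w`,
  `w ∈ F`, `w.w = -ε` (again by the first point applied to `F`).
* `exists_isotropic_of_isIndefinite_of_finrank_le_five`: **Serre's Theorem 3 in ranks `≤ 5`**,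
  unconditionally: a symmetric unimodular indefinite lattice of rank `≤ 5` represents zero.

Serre's own proof of Theorem 3 (Ch. V §3.1) treats `n = 2` by `d = -1`, `n = 3, 4` by the
Hasse–Minkowski theorem (Ch. IV §3.2 Thm 8, Cor. 3) and `n ≥ 5` by Meyer's theorem (Cor. 2);
the reduction-theoretic argument used here for `n ≤ 5` is the classical one by which unimodular
lattices of small rank are classified (Hermite, Minkowski; cf. Milnor–Husemoller II §§2, 6), and
needs no `p`-adic input. Ranks `≥ 5` are reduced to Meyer's theorem in
`LatticeFormsRepresentsZeroProofs.lean`.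

`ℤ`-lattices carry the canonical structure `AddCommGroup.toIntModule` (only `[AddCommGroup M]` is
assumed), as in the sibling files; declarations extend the Mathlib namespace `LinearMap.BilinForm`
by dot-notation lemmas on `IsUnimodular`/`IsDefinite`/`IsIndefinite` (deliberate, as in
`LatticeForms.lean`).

## Sources

* J.-P. Serre, *A Course in Arithmetic* (GTM 7, Springer 1973), Ch. V §2.2 Thm 3, §3.1, §3.2
  Lemma 2 (PDF pp. 50, 52–53). [Serre1973]
* J. W. S. Cassels, *An Introduction to the Geometry of Numbers* (Springer Classics 1997),
  Ch. II §3.2 Thm. I. [Cassels1997]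
-/

open Module
open LinearMap (BilinForm)
open Literature.NumberTheory.QuadraticForms

universe u

namespace LinearMap.BilinForm

variable {M : Type u} [AddCommGroup M]

/-! ### A vector of square `0` or `±1` in rank `≤ 5` -/

/-- The numerical fact behind rank `≤ 5`: `3^{n(n-1)/2} · 2ⁿ > 4^{n(n-1)/2}` for `1 ≤ n ≤ 5`,
i.e. Hermite's constant `(4/3)^{(n-1)/2}` is `< 2`. [folklore] -/
theorem four_pow_choose_lt (n : ℕ) (h1 : 1 ≤ n) (h5 : n ≤ 5) :
    4 ^ n.choose 2 < 3 ^ n.choose 2 * 2 ^ n := by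
  interval_cases n <;> simp [Nat.choose]

/-- **Small vectors in unimodular lattices of rank `≤ 5`.** A symmetric unimodular lattice of rank
`1 ≤ n ≤ 5` contains `u ≠ 0` with `|B(u,u)| ≤ 1`: by Hermite's inequality (Cassels, *Geometry of
Numbers* II.3.2 Thm. I, `exists_ne_zero_natAbs_pow_le`) some `u ≠ 0` has
`3^{n(n-1)/2} |u.u|ⁿ ≤ 4^{n(n-1)/2} |det| = 4^{n(n-1)/2}`, and `|u.u| ≥ 2` is impossible for
`n ≤ 5`. [cite: Cassels1997, Ch. II §3.2 Thm. I] -/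
theorem exists_ne_zero_natAbs_apply_self_le_one [Module.Finite ℤ M] [Module.Free ℤ M]
    [Nontrivial M] {B : BilinForm ℤ M} (hB : B.IsSymm) (hu : B.IsUnimodular)
    (h5 : finrank ℤ M ≤ 5) : ∃ u : M, u ≠ 0 ∧ (B u u).natAbs ≤ 1 := by
  classical
  have hn : 0 < finrank ℤ M := (Module.finrank_pos_iff_of_free ℤ M).mpr inferInstance
  obtain ⟨k, hk⟩ : ∃ k, finrank ℤ M = k + 1 := Nat.exists_eq_succ_of_ne_zero hn.ne'
  let b : Basis (Fin (k + 1)) ℤ M := (Module.finBasis ℤ M).reindex (finCongr hk)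
  obtain ⟨u, hu0, hle⟩ := exists_ne_zero_natAbs_pow_le b hB
  have hdet : (LinearMap.BilinForm.toMatrix b B).det.natAbs = 1 :=
    Int.isUnit_iff_natAbs_eq.mp ((isUnimodular_iff_isUnit_det_holds B b).mp hu)
  rw [hdet, mul_one] at hle
  refine ⟨u, hu0, ?_⟩
  by_contra h
  have h2 : 2 ≤ (B u u).natAbs := by omega
  have := four_pow_choose_lt (k + 1) (by omega) (by omega)
  have : 3 ^ (k + 1).choose 2 * 2 ^ (k + 1) ≤ 4 ^ (k + 1).choose 2 :=
    le_trans (Nat.mul_le_mul_left _ (Nat.pow_le_pow_left h2 _)) hle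
  omega

/-! ### Anisotropic unimodular lattices of rank `≤ 5` are definite -/

/-- The rank-one lattice `⟨1⟩ = I₊` (`(a, b) ↦ a b` on `ℤ`) is positive definite. [folklore] -/
theorem posDef_one_smul_mul : BilinForm.PosDef ((1 : ℤ) • LinearMap.mul ℤ ℤ) :=
  (posDef_iff _).mpr fun a ha => by rw [smul_mul_apply, one_mul]; exact mul_self_pos.mpr ha

/-- The rank-one lattice `⟨-1⟩ = I₋` is negative definite. [folklore] -/
theorem negDef_neg_one_smul_mul : BilinForm.NegDef ((-1 : ℤ) • LinearMap.mul ℤ ℤ) :=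
  (negDef_iff _).mpr fun a ha => by
    rw [smul_mul_apply, neg_one_mul, neg_lt_zero]
    exact mul_self_pos.mpr ha

/-- An isotropic vector from a unit vector and an orthogonal vector of the opposite unit square:
if `B(v,v) = ε`, `B(v,w) = 0`, `B(w,w) = -ε` with `ε ≠ 0`, then `v + w ≠ 0` and
`B(v + w, v + w) = 0`; so `B` is not anisotropic. [folklore] -/
theorem exists_isotropic_of_unit_of_neg_unit {B : BilinForm ℤ M} (hB : B.IsSymm) {v w : M}
    {ε : ℤ} (hε : ε ≠ 0) (hv : B v v = ε) (hvw : B v w = 0) (hw : B w w = -ε) :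
    ∃ x : M, x ≠ 0 ∧ B x x = 0 := by
  refine ⟨v + w, fun h0 => ?_, ?_⟩
  · have hwv : w = -v := eq_neg_of_add_eq_zero_right h0
    rw [hwv, map_neg, hv, neg_eq_zero] at hvw
    exact hε hvw
  · have hwv' : B w v = 0 := by rw [hB.eq, hvw]
    simp only [map_add, LinearMap.add_apply, hv, hvw, hwv', hw]
    ring

/-- **Anisotropic unimodular lattices of rank `≤ 5` are definite** (inductive form, rank `≤ n`).
A symmetric unimodular lattice `E` of rank `≤ 5` with `x.x ≠ 0` for all `x ≠ 0` is positive or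
negative definite: take `u` with `u.u = ε = ±1` (`exists_ne_zero_natAbs_apply_self_le_one`),
split `E ≅ ⟨ε⟩ ⊕ u^⊥` (Serre, Ch. V §3.2 Lemma 2, `IsometryEquiv.splitUnit`); `u^⊥` is
unimodular, anisotropic, of smaller rank, hence definite by induction; if its sign were opposite
to `ε`, a vector `w ∈ u^⊥` with `w.w = -ε` (same lemma) would give the isotropic vector `u + w`.
[cite: Serre1973, Ch. V §3.2 Lemma 2] -/
theorem isDefinite_of_forall_apply_self_ne_zero_aux (n : ℕ) (hn5 : n ≤ 5) :
    ∀ (M : Type u) [AddCommGroup M] [Module.Finite ℤ M] [Module.Free ℤ M] (B : BilinForm ℤ M),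
      finrank ℤ M ≤ n → B.IsSymm → B.IsUnimodular → (∀ v : M, v ≠ 0 → B v v ≠ 0) →
      B.IsDefinite := by
  induction n with
  | zero =>
    intro M _ _ _ B h0 _ _ _
    haveI : Subsingleton M := (Module.finrank_eq_zero_iff_of_free ℤ M).mp (by omega)
    exact isDefinite_of_subsingleton B
  | succ n ih =>
    intro M _ _ _ B hrank hB hu han
    by_cases hM : Subsingleton M
    · exact isDefinite_of_subsingleton B
    haveI : Nontrivial M := not_subsingleton_iff_nontrivial.mp hM
    -- a vector of square `ε = ±1`
    obtain ⟨v, hv0, hv1⟩ := exists_ne_zero_natAbs_apply_self_le_one hB hu (by omega)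
    have hvabs : (B v v).natAbs = 1 := by
      have := Int.natAbs_pos.mpr (han v hv0)
      omega
    obtain ⟨ε, hε, hvε⟩ : ∃ ε : ℤ, (ε = 1 ∨ ε = -1) ∧ B v v = ε := by
      rcases Int.natAbs_eq_iff.mp hvabs with h | h
      · exact ⟨1, Or.inl rfl, h⟩
      · exact ⟨-1, Or.inr rfl, h⟩
    have hεε : ε * ε = 1 := by rcases hε with rfl | rfl <;> norm_num
    have hε0 : ε ≠ 0 := by rcases hε with rfl | rfl <;> norm_num
    -- Lemma 2: `E ≅ ⟨ε⟩ ⊕ U`, `U = v^⊥` unimodular anisotropic of rank `≤ n`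
    set U : Submodule ℤ M := B.orthogonal (ℤ ∙ v) with hUdef
    have hU1 : finrank ℤ M = finrank ℤ U + 1 :=
      finrank_eq_finrank_orthogonal_singleton_add_one hB v hvε hεε
    have hUu : (B.restrict U).IsUnimodular :=
      isUnimodular_restrict_orthogonal_singleton hu hB v hvε hεε
    have hUs : (B.restrict U).IsSymm := hB.restrict U
    have hUan : ∀ w : U, w ≠ 0 → (B.restrict U) w w ≠ 0 := fun w hw0 =>
      han w fun h => hw0 (Subtype.ext h)
    have hUdef' : (B.restrict U).IsDefinite := ih (by omega) U (B.restrict U) (by omega) hUs hUu hUan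
    have e : B.Equivalent (BilinForm.prod (ε • LinearMap.mul ℤ ℤ) (B.restrict U)) :=
      ⟨IsometryEquiv.splitUnit hB v hvε hεε⟩
    -- a vector `w ∈ U` of square `-ε` contradicts anisotropy
    have hno : ∀ w : U, w ≠ 0 → B w w = -ε → False := fun w hw0 hww => by
      have hvw : B v w = 0 := (mem_orthogonal_span_singleton_iff B).mp w.2
      obtain ⟨x, hx0, hx⟩ := exists_isotropic_of_unit_of_neg_unit hB hε0 hvε hvw hww
      exact han x hx0 hx
    -- in the mismatched cases `U ≠ 0`, and `U` has a unit vector of the wrong sign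
    have hmis : ¬ Subsingleton U → ∃ w : U, w ≠ 0 ∧ (B w w).natAbs = 1 := fun hU0 => by
      haveI : Nontrivial U := not_subsingleton_iff_nontrivial.mp hU0
      obtain ⟨w, hw0, hw1⟩ := exists_ne_zero_natAbs_apply_self_le_one hUs hUu (by omega)
      have h0 : 0 < (B (w : M) w).natAbs := Int.natAbs_pos.mpr (hUan w hw0)
      exact ⟨w, hw0, by change (B w w).natAbs ≤ 1 at hw1; omega⟩
    have hU0def : Subsingleton U → (B.restrict U).PosDef ∧ (B.restrict U).NegDef := fun hU0 =>
      ⟨(posDef_iff _).mpr fun w hw => absurd (Subsingleton.elim w 0) hw,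
        (negDef_iff _).mpr fun w hw => absurd (Subsingleton.elim w 0) hw⟩
    have hposE : ε = 1 → (B.restrict U).PosDef → B.IsDefinite := fun h1 hpos =>
      Or.inl ((posDef_iff_of_equivalent e).mpr
        (posDef_prod_iff.mpr ⟨by subst h1; exact posDef_one_smul_mul, hpos⟩))
    have hnegE : ε = -1 → (B.restrict U).NegDef → B.IsDefinite := fun h1 hneg =>
      Or.inr ((negDef_iff_of_equivalent e).mpr
        (negDef_prod_iff.mpr ⟨by subst h1; exact negDef_neg_one_smul_mul, hneg⟩))
    rcases hUdef' with hpos | hneg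
    · rcases hε with h1 | h1
      · exact hposE h1 hpos
      · by_cases hU0 : Subsingleton U
        · exact hnegE h1 (hU0def hU0).2
        · exfalso
          obtain ⟨w, hw0, hw1⟩ := hmis hU0
          have hwpos : 0 < B w w := (posDef_iff _).mp hpos w hw0
          exact hno w hw0 (by subst h1; omega)
    · rcases hε with h1 | h1
      · by_cases hU0 : Subsingleton U
        · exact hposE h1 (hU0def hU0).1
        · exfalso
          obtain ⟨w, hw0, hw1⟩ := hmis hU0
          have hwneg : B w w < 0 := (negDef_iff _).mp hneg w hw0
          exact hno w hw0 (by subst h1; omega)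
      · exact hnegE h1 hneg

/-- **Anisotropic unimodular lattices of rank `≤ 5` are definite.** A symmetric unimodular
lattice of rank `≤ 5` on which `x.x ≠ 0` for every `x ≠ 0` is positive or negative definite
(hence `≅ ± Iₙ`; classical reduction theory, via Hermite's bound and Serre's Lemma 2,
*A Course in Arithmetic*, Ch. V §3.2). Contrapositive form of Theorem 3 in these ranks.
[cite: Serre1973, Ch. V §3.2 Lemma 2] -/
theorem isDefinite_of_forall_apply_self_ne_zero [Module.Finite ℤ M] [Module.Free ℤ M]
    {B : BilinForm ℤ M} (hB : B.IsSymm) (hu : B.IsUnimodular) (h5 : finrank ℤ M ≤ 5)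
    (han : ∀ v : M, v ≠ 0 → B v v ≠ 0) : B.IsDefinite :=
  isDefinite_of_forall_apply_self_ne_zero_aux 5 le_rfl M B h5 hB hu han

/-- **Serre's Theorem 3 in rank `≤ 5`** (unconditional): a symmetric unimodular indefinite
lattice of rank `≤ 5` represents zero, i.e. has `x ≠ 0` with `x.x = 0`. Serre, *A Course in
Arithmetic*, Ch. V §2.2 Thm 3 ("If `E ∈ S` is indefinite, `E` represents zero"), cases
`n ≤ 5` of the proof in §3.1; proved here by reduction theory
(`isDefinite_of_forall_apply_self_ne_zero`) instead of the Hasse–Minkowski theorem. The general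
case is the named fact `exists_isotropic_of_isIndefinite` (`LatticeFormsRepresentsZero.lean`).
[cite: Serre1973, Ch. V §2.2 Thm 3] -/
theorem exists_isotropic_of_isIndefinite_of_finrank_le_five [Module.Finite ℤ M] [Module.Free ℤ M]
    {B : BilinForm ℤ M} (hB : B.IsSymm) (hu : B.IsUnimodular) (hind : B.IsIndefinite)
    (h5 : finrank ℤ M ≤ 5) : ∃ x : M, x ≠ 0 ∧ B x x = 0 := by
  by_contra h
  push Not at h
  exact hind (isDefinite_of_forall_apply_self_ne_zero hB hu h5 fun v hv h0 => h v hv h0)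

end LinearMap.BilinForm
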